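import Literature.Probability.LatticeModels.RandomClusterEdgeWeights
import Literature.Probability.LatticeModels.RandomClusterPinnedComparison
import HarnessLib

/-!
# `NoHeavyLowerTail` (stmt-CriticalPhenomena-4575) — the 3-sum theorem for R1, measure level, part 1:
# cluster counts of a configuration glued from two pieces along a wired vertex separator

Support file (prover prim-gen-kcluster gen 71; `--supports stmt-CriticalPhenomena-4575`).  Pure graph
combinatorics: no measures, no definitions, no named facts, no sorries.

This is step (3) of the blueprint KCLUSTER-gen69.md §9 (N3b) for the kernel MEASURE-LEVEL form of the
3-sum theorem of R1 (`WheelR1.wheel_certificate`, p375044): the bookkeeping of the random-cluster factor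
`q^{k(ω)}` when a configuration `ω = ζ_A ∪ ζ_B` is glued from two pieces whose pairs meet only in a
terminal set `T`.

* `ThreeSum.openGraph_union` — `openGraph (X ∪ Y) = openGraph X ⊔ openGraph Y`.
* `ThreeSum.reachable_wired_of_reachable_union_wired` — PROJECTION LEMMA: if the pairs of `Y` meet the
  pairs of `X` only inside `T ∋ t₀`, then between two vertices not touched by `Y` off `T`, reachability in
  `openGraph (X ∪ Y) ⊔ wired T` already holds in `openGraph X ⊔ wired T` (project every vertex touched by
  `Y` off `T` to `t₀`: every step of a walk stays a step or becomes trivial).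
* `ThreeSum.clusterCount_union_add_wired` — **WIRED ADDITIVITY ACROSS A VERTEX SEPARATOR**: with `T`
  wired, `k^T(ζ_A ∪ ζ_B) + k^T(∅) = k^T(ζ_A) + k^T(ζ_B)` whenever the pairs of `ζ_A` and of `ζ_B` meet only
  inside `T` (induction on `ζ_A`: a new `A`-pair merges two classes on the left iff it does on the right,
  by the projection lemma) — the analogue for a VERTEX cut of the tree's closed-EDGE-cut identity
  `clusterCount_union_add_eq_of_closed_cut` (Grimmett 2006, Thm. (3.1)(a), Lemma (4.13)).
* `ThreeSum.clusterCount_empty_eq_wired_three` — **FREE VERSUS WIRED AT THREE POINTS**: for distinct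
  `a, b, c` and every `ω`,
  `k(ω) = k^{{a,b,c}}(ω) + [a ↮ b] + [a ↮ c ∧ b ↮ c]`,
  i.e. `k = k^T + (number of blocks of the partition of {a,b,c} induced by ω) − 1` (wire `T` by adding
  the edges `ab`, `ac`, `bc` one at a time).
Together: on each three-point cell of the glued graph the free count `k(ζ_A ∪ ζ_B)` is
`k^T(ζ_A) + k^T(ζ_B) − k^T(∅) + (blocks − 1)`, which is what turns the glued cell masses into bilinear
forms in the pieces' (T-wired) cell masses (parts 2–4).
[cite: Grimmett2006, Thm. (3.1)(a) and §4.2 Lemma (4.13) (pattern: cluster counts across a cut)]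
-/

namespace Summit.CriticalPhenomena.PercolationContinuityZ3.Theorems

namespace ThreeSum

open SimpleGraph Literature.Probability.Percolation Literature.Probability.LatticeModels

variable {V : Type*}

/-! ### Open graphs of unions; one more edge -/

/-- The open graph of a union of configurations is the join of the open graphs. [folklore] -/
theorem openGraph_union (X Y : BondConfig V) : openGraph (X ∪ Y) = openGraph X ⊔ openGraph Y := by
  unfold openGraph; exact fromEdgeSet_union X Y

/-- Opening the pair `s(u,v)` adds the edge `uv` to the open graph (nothing if `u = v`). [folklore] -/
theorem openGraph_insert (X : BondConfig V) (u v : V) :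
    openGraph (insert s(u, v) X) = openGraph X ⊔ edge u v := by
  rw [Set.insert_eq, Set.union_comm, openGraph_union, edge]
  rfl

/-- The number of connected components after adding the edge `uv` (finite vertex type): it drops by one
if `u, v` were not joined and is unchanged otherwise. [folklore] -/
theorem card_cc_sup_edge [Finite V] (H : SimpleGraph V) (u v : V) [Decidable (H.Reachable u v)] :
    Nat.card (H ⊔ edge u v).ConnectedComponent + (if H.Reachable u v then 0 else 1) =
      Nat.card H.ConnectedComponent := by
  split_ifs with h
  · rw [add_zero, card_connectedComponent_sup_edge_of_reachable H h]
  · have h1 := card_connectedComponent_sup_edge_lt H h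
    have h2 := card_connectedComponent_le_sup_edge_add_one H u v
    omega

/-! ### The projection lemma -/

section Projection

variable {X Y : BondConfig V} {T : Set V} {t₀ : V}

/-- **Projection lemma.**  Let the pairs of `Y` meet the pairs of `X` only inside `T`, and `t₀ ∈ T`.
Project every vertex lying on a pair of `Y` but outside `T` to `t₀` and fix all other vertices.  Then
every edge of `openGraph (X ∪ Y) ⊔ wired T` is sent to an edge of `openGraph X ⊔ wired T` or collapsed,
so reachability is transported. [this work] -/
theorem reachable_proj_of_reachable_union_wired
    (hmeet : ∀ e ∈ X, ∀ e' ∈ Y, ∀ x, x ∈ e → x ∈ e' → x ∈ T) (ht₀ : t₀ ∈ T)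
    (ρ : V → V) (hρT : ∀ z, (z ∉ T ∧ ∃ e' ∈ Y, z ∈ e') → ρ z = t₀)
    (hρid : ∀ z, ¬ (z ∉ T ∧ ∃ e' ∈ Y, z ∈ e') → ρ z = z) {x y : V}
    (h : (openGraph (X ∪ Y) ⊔ wired T).Reachable x y) :
    (openGraph X ⊔ wired T).Reachable (ρ x) (ρ y) := by
  classical
  -- the image of a vertex on a `Y`-pair lies in `T`
  have hY : ∀ z, (∃ e' ∈ Y, z ∈ e') → ρ z ∈ T := by
    intro z hz
    by_cases hzT : z ∈ T
    · rw [hρid z (fun h => h.1 hzT)]; exact hzT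
    · rw [hρT z ⟨hzT, hz⟩]; exact ht₀
  -- vertices of `T` are fixed
  have hT : ∀ z ∈ T, ρ z = z := fun z hz => hρid z (fun h => h.1 hz)
  -- two vertices of `T` are joined in the wired graph
  have hTT : ∀ z z', z ∈ T → z' ∈ T → (openGraph X ⊔ wired T).Reachable z z' := by
    intro z z' hz hz'
    by_cases hzz : z = z'
    · subst hzz; exact Reachable.refl _
    · refine Adj.reachable ?_
      rw [sup_adj, wired_adj]; exact Or.inr ⟨hzz, hz, hz'⟩
  -- one step
  have step : ∀ z z', (openGraph (X ∪ Y) ⊔ wired T).Adj z z' →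
      (openGraph X ⊔ wired T).Reachable (ρ z) (ρ z') := by
    intro z z' hzz'
    rw [sup_adj, openGraph_adj, Set.mem_union, wired_adj] at hzz'
    rcases hzz' with ⟨hXY | hYY, hne⟩ | ⟨hne, hz, hz'⟩
    · -- an `X`-pair: both endpoints are fixed
      have fixX : ∀ w, w ∈ s(z, z') → ρ w = w := by
        intro w hw
        by_cases hwY : ∃ e' ∈ Y, w ∈ e'
        · obtain ⟨e', he', hwe'⟩ := hwY
          exact hT w (hmeet _ hXY e' he' w hw hwe')
        · exact hρid w (fun h => hwY h.2)
      rw [fixX z (Sym2.mem_mk_left z z'), fixX z' (Sym2.mem_mk_right z z')]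
      refine Adj.reachable ?_
      rw [sup_adj, openGraph_adj]; exact Or.inl ⟨hXY, hne⟩
    · -- a `Y`-pair: both images lie in `T`
      exact hTT _ _ (hY z ⟨_, hYY, Sym2.mem_mk_left z z'⟩) (hY z' ⟨_, hYY, Sym2.mem_mk_right z z'⟩)
    · -- a wired pair
      rw [hT z hz, hT z' hz']; exact hTT z z' hz hz'
  obtain ⟨p⟩ := h
  induction p with
  | nil => exact Reachable.refl _
  | @cons u w v huw _ ih => exact (step u w huw).trans ih

/-- **Reachability between `A`-side vertices does not use the `B`-piece** (up to the wiring of `T`):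
if the pairs of `Y` meet those of `X` only inside `T ∋ t₀`, and `x, y` do not lie on pairs of `Y` unless
they are in `T`, then `x ↔ y` in `openGraph (X ∪ Y) ⊔ wired T` iff in `openGraph X ⊔ wired T`. [this work] -/
theorem reachable_union_wired_iff
    (hmeet : ∀ e ∈ X, ∀ e' ∈ Y, ∀ x, x ∈ e → x ∈ e' → x ∈ T) (ht₀ : t₀ ∈ T) {x y : V}
    (hx : (∃ e' ∈ Y, x ∈ e') → x ∈ T) (hy : (∃ e' ∈ Y, y ∈ e') → y ∈ T) :
    (openGraph (X ∪ Y) ⊔ wired T).Reachable x y ↔ (openGraph X ⊔ wired T).Reachable x y := by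
  classical
  refine ⟨fun h => ?_, fun h => h.mono ?_⟩
  · set ρ : V → V := fun z => if (z ∉ T ∧ ∃ e' ∈ Y, z ∈ e') then t₀ else z with hρ
    have key := reachable_proj_of_reachable_union_wired hmeet ht₀ ρ
      (fun z hz => by simp only [hρ]; rw [if_pos hz]) (fun z hz => by simp only [hρ]; rw [if_neg hz]) h
    have hxρ : ρ x = x := by
      simp only [hρ]; rw [if_neg]; exact fun h' => h'.1 (hx h'.2)
    have hyρ : ρ y = y := by
      simp only [hρ]; rw [if_neg]; exact fun h' => h'.1 (hy h'.2)
    rwa [hxρ, hyρ] at key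
  · rw [openGraph_union]
    exact sup_le_sup_right le_sup_left _

end Projection

/-! ### Wired additivity across a vertex separator -/

/-- **Wired additivity across a vertex separator.**  If the pairs of `ζ_A` and the pairs of `ζ_B` meet
only inside `T`, and `T` is non-empty, then with `T` wired
`k^T(ζ_A ∪ ζ_B) + k^T(∅) = k^T(ζ_A) + k^T(ζ_B)`.
(Induction on the finite set `ζ_A`: by `reachable_union_wired_iff` a new `A`-pair merges two classes of
`⟨ζ_A ∪ ζ_B⟩ ∨ K_T` iff it merges two classes of `⟨ζ_A⟩ ∨ K_T`.)  The vertex-cut analogue of the tree's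
`clusterCount_union_add_eq_of_closed_cut`. [cite: Grimmett2006, Thm. (3.1)(a), §4.2 Lemma (4.13) (pattern)] -/
theorem clusterCount_union_add_wired [Finite V] {ζA ζB : BondConfig V} {T : Set V} {t₀ : V}
    (hmeet : ∀ e ∈ ζA, ∀ e' ∈ ζB, ∀ x, x ∈ e → x ∈ e' → x ∈ T) (ht₀ : t₀ ∈ T) :
    clusterCount (ζA ∪ ζB) T + clusterCount (∅ : BondConfig V) T =
      clusterCount ζA T + clusterCount ζB T := by
  classical
  haveI : Fintype V := Fintype.ofFinite V
  -- induction on a finite set of `A`-pairs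
  have main : ∀ s : Finset (Sym2 V), (↑s : Set (Sym2 V)) ⊆ ζA →
      clusterCount ((↑s : Set (Sym2 V)) ∪ ζB) T + clusterCount (∅ : BondConfig V) T =
        clusterCount (↑s : BondConfig V) T + clusterCount ζB T := by
    intro s
    induction s using Finset.induction_on with
    | empty =>
      intro _
      rw [Finset.coe_empty, Set.empty_union, add_comm]
    | insert e s hes ih =>
      intro hsub
      have hs : (↑s : Set (Sym2 V)) ⊆ ζA := fun f hf => hsub (Finset.mem_coe.2 (Finset.mem_insert_of_mem hf))
      have he : e ∈ ζA := hsub (Finset.mem_coe.2 (Finset.mem_insert_self e s))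
      have ih' := ih hs
      induction e using Sym2.ind with
      | h u v =>
        -- endpoints of an `A`-pair lie on `B`-pairs only inside `T`
        have hu : (∃ e' ∈ ζB, u ∈ e') → u ∈ T := fun ⟨e', he', hue'⟩ =>
          hmeet _ he e' he' u (Sym2.mem_mk_left u v) hue'
        have hv : (∃ e' ∈ ζB, v ∈ e') → v ∈ T := fun ⟨e', he', hve'⟩ =>
          hmeet _ he e' he' v (Sym2.mem_mk_right u v) hve'
        have hmeet' : ∀ f ∈ (↑s : Set (Sym2 V)), ∀ e' ∈ ζB, ∀ x, x ∈ f → x ∈ e' → x ∈ T :=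
          fun f hf e' he' x hx hx' => hmeet f (hs hf) e' he' x hx hx'
        have hiff := reachable_union_wired_iff hmeet' ht₀ hu hv
        -- the two graphs after inserting `uv`
        have h1 : openGraph ((↑(insert s(u, v) s) : Set (Sym2 V)) ∪ ζB) ⊔ wired T =
            (openGraph ((↑s : Set (Sym2 V)) ∪ ζB) ⊔ wired T) ⊔ edge u v := by
          rw [Finset.coe_insert, Set.insert_union, openGraph_insert, sup_right_comm]
        have h2 : openGraph (↑(insert s(u, v) s) : Set (Sym2 V)) ⊔ wired T =
            (openGraph (↑s : Set (Sym2 V)) ⊔ wired T) ⊔ edge u v := by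
          rw [Finset.coe_insert, openGraph_insert, sup_right_comm]
        unfold clusterCount at ih' ⊢
        rw [h1, h2]
        have hstep := card_connectedComponent_sup_edge_add_eq hiff.symm
        omega
  have hfin : (ζA.toFinset : Set (Sym2 V)) = ζA := Set.coe_toFinset ζA
  have := main ζA.toFinset (by rw [hfin])
  rwa [hfin] at this

/-! ### Free versus wired count at three points -/

section Three

variable [Finite V] {a b c : V}

omit [Finite V] in
/-- Wiring `{a,b,c}` is adding the three edges `ab`, `ac`, `bc` (for distinct `a, b, c`). [folklore] -/
theorem sup_wired_three_eq (hab : a ≠ b) (hac : a ≠ c) (hbc : b ≠ c) (H : SimpleGraph V) :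
    H ⊔ wired ({a, b, c} : Set V) = ((H ⊔ edge a b) ⊔ edge a c) ⊔ edge b c := by
  ext x y
  simp only [sup_adj, wired_adj, edge_adj, Set.mem_insert_iff, Set.mem_singleton_iff, ne_eq]
  constructor
  · rintro (h | ⟨hne, hx, hy⟩)
    · exact Or.inl (Or.inl (Or.inl h))
    · rcases hx with rfl | rfl | rfl <;> rcases hy with rfl | rfl | rfl <;> tauto
  · rintro (((h | ⟨h, hne⟩) | ⟨h, hne⟩) | ⟨h, hne⟩)
    · exact Or.inl h
    all_goals
      rcases h with ⟨rfl, rfl⟩ | ⟨rfl, rfl⟩ <;> exact Or.inr ⟨hne, by tauto⟩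

/-- **Free versus wired count at three points.**  For distinct `a, b, c` and every configuration `ω`,
`k(ω) = k^{{a,b,c}}(ω) + [a ↮ b] + [a ↮ c ∧ b ↮ c]` (reachability in `openGraph ω`): the free count
exceeds the count with `{a,b,c}` wired by (number of blocks of the partition of `{a,b,c}` induced by the
open clusters) `− 1`.  Proof: wire by adding the edges `ab`, `ac`, `bc` one at a time and count the merges
(`card_cc_sup_edge`, `reachable_sup_edge_imp`). [this work] -/
theorem clusterCount_empty_eq_wired_three (hab : a ≠ b) (hac : a ≠ c) (hbc : b ≠ c) (ω : BondConfig V)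
    [Decidable ((openGraph ω).Reachable a b)]
    [Decidable ((openGraph ω).Reachable a c ∨ (openGraph ω).Reachable b c)] :
    clusterCount ω ∅ = clusterCount ω ({a, b, c} : Set V) +
      (if (openGraph ω).Reachable a b then 0 else 1) +
      (if ((openGraph ω).Reachable a c ∨ (openGraph ω).Reachable b c) then 0 else 1) := by
  classical
  set G₀ := openGraph ω with hG₀
  set G₁ := G₀ ⊔ edge a b with hG₁
  set G₂ := G₁ ⊔ edge a c with hG₂
  -- step 1: add `ab`
  have s1 := card_cc_sup_edge G₀ a b
  -- step 2: add `ac`; `a ~ c` in `G₁` iff `a ~ c` or `b ~ c` in `G₀`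
  have hac1 : G₁.Reachable a c ↔ (G₀.Reachable a c ∨ G₀.Reachable b c) := by
    constructor
    · intro h
      rcases reachable_sup_edge_imp G₀ a b h with h | ⟨_, h⟩ | ⟨_, h⟩
      · exact Or.inl h
      · exact Or.inr h
      · exact Or.inl h
    · rintro (h | h)
      · exact h.mono le_sup_left
      · have hab' : G₁.Reachable a b := by
          refine Adj.reachable ?_
          rw [hG₁, sup_adj, edge_adj]; exact Or.inr ⟨Or.inl ⟨rfl, rfl⟩, hab⟩
        exact hab'.trans (h.mono le_sup_left)
  have s2 := card_cc_sup_edge G₁ a c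
  -- step 3: add `bc`; now `b ~ c` already
  have hbc2 : G₂.Reachable b c := by
    have h1 : G₂.Adj b a := by
      rw [hG₂, sup_adj, hG₁, sup_adj, edge_adj]; exact Or.inl (Or.inr ⟨Or.inr ⟨rfl, rfl⟩, hab.symm⟩)
    have h2 : G₂.Adj a c := by
      rw [hG₂, sup_adj, edge_adj]; exact Or.inr ⟨Or.inl ⟨rfl, rfl⟩, hac⟩
    exact h1.reachable.trans h2.reachable
  have s3 := card_connectedComponent_sup_edge_of_reachable G₂ hbc2
  -- assemble
  have hW : clusterCount ω ({a, b, c} : Set V) = Nat.card (G₂ ⊔ edge b c).ConnectedComponent := by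
    unfold clusterCount; rw [sup_wired_three_eq hab hac hbc]
  have h0 : clusterCount ω ∅ = Nat.card G₀.ConnectedComponent := by
    unfold clusterCount; rw [wired_empty, sup_bot_eq]
  rw [← hG₁] at s1
  rw [← hG₂] at s2
  rw [hW, h0, s3]
  by_cases h₁ : G₀.Reachable a b <;> by_cases h₂ : (G₀.Reachable a c ∨ G₀.Reachable b c)
  · rw [if_pos h₁] at s1; rw [if_pos (hac1.2 h₂)] at s2; rw [if_pos h₁, if_pos h₂]; omega
  · rw [if_pos h₁] at s1; rw [if_neg (fun h => h₂ (hac1.1 h))] at s2; rw [if_pos h₁, if_neg h₂]; omega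
  · rw [if_neg h₁] at s1; rw [if_pos (hac1.2 h₂)] at s2; rw [if_neg h₁, if_pos h₂]; omega
  · rw [if_neg h₁] at s1; rw [if_neg (fun h => h₂ (hac1.1 h))] at s2; rw [if_neg h₁, if_neg h₂]; omega

end Three

end ThreeSum

end Summit.CriticalPhenomena.PercolationContinuityZ3.Theorems
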